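import Literature.MathematicalPhysics.QuantumFieldTheory.Balaban1983to89.B9SectBCodedClassKnitY

/-!
# `Balaban1983to89.B9SectBCodedClassKnitYStraight` — THE DISPLAYED TRANSPORTER-VARIATION LAW `ParVar337Y` HOLDS AT THE STRAIGHT (TAXICAB) TRANSPORTER `parSymY`
# (non-vacuity of the law's shape; the generic-transporter packaging of `B9SectBCodedClassKnitY` re-derives (3.58)∕(3.59) at `parSymY`)

T. Bałaban, *Propagators for lattice gauge theories in a background field*, Commun. Math. Phys. **99** (1985) 389–434 [`Balaban1985BackgroundPropagators`, "B9"];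
[4] = T. Bałaban, *Propagators and renormalization transformations for lattice gauge theories. II*, Commun. Math. Phys. **96** (1984) 223–250 [`Balaban1984PropagatorsII`].

statement-level skeleton of published theorems with citation tags; proofs where landed; nothing here is a claim about the Yang–Mills mass gap

THE PRINTED LOCUS.  p. 401 (after (3.56)): *«… by the above bounds |(U′U)(Γ^{(j)}_{y,x})(U(Γ^{(j)}_{y,x}))⁻¹ − 1| < O(1)α₁.»*; (3.37) p. 396; (3.40) p. 397 («a shortest contour»).

WHY THIS FILE (pub-ymgap N06, seat dag-n06-c g26, companion of `B9SectBCodedClassKnitY` ✓).  That file DISPLAYS the key estimate of p. 401 as a law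
`ParVar337Y G i par R Cp αK aK` of a transporter table `par` (corner-pair variation `≦ C_p·α₁` under a (3.37) multiplier over regular `G`-valued bases) and builds the
seven letters of the coded class from it for ANY table (`cplxLettersY_of_cplx337_par`); at the KNIT table `parKnitY` the law is dag-n06-l's (K1).  THIS FILE shows the
law's shape is the right currency by INHABITING it at NODE 00's straight table `parSymY` from the tree's elementary taxicab estimate
`B9Eq358TaxiLettersY.norm_parTaxiV_prod_sub_le` — `C_p = 2(d+1)e^{(d+1)/2}`, `α_K = 1∕4`, for EVERY regularity predicate `R` and threshold `a_K` (the straight estimate needs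
only «`U` is `G`-valued»): `parVar337Y_parSymY`; and the membership law `ParMemY` at `parSymY` (`parMemY_parSymY`, from def-Y's `Node00.parSymY_mem`).

HONEST SCOPE.  A repackaging of a landed elementary estimate; nothing of Thm 3.1 ∕ 3.4 asserted; COUNT-NEUTRAL; N06 NOT discharged; one finite lattice programme — nothing
continuum ∕ OS ∕ mass-gap ∕ Clay.  Cell `pub-ymgap` (HUMAN RULING D-0062), Track A node N06 [B9], 2026-08-30.  NEW file; nothing landed is modified.
-/

noncomputable section

namespace Literature.MathematicalPhysics.QuantumFieldTheory.Balaban1983to89.B9SectBCodedClassKnitYStraight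

open Complex
open B6Geom246MultiLevelBox (blkOf)
open B6GlobalChartV1 (PV toBox boxEquiv)
open B6KLevelCensusIndexV1 (KIdx kGeo)
open B9BackgroundsKLevelV1 (shiftsV1 levV1)
open B9Eq39Adjoint (fluct)
open B9Eq335RegularityClasses (Cplx337)
open LatticeNorms (scaleLen)
open B9Eq360DeltaPrimeAY (mulY AfldY blkY blkY_apply)
open B9SectBGpLettersY (GVal)
open B9SectBCodedClassKnitY (ParVar337Y ParMemY)
open B9Eq358TaxiLettersY (norm_parTaxiV_prod_sub_le toLex_corner_le val_sub_corner val_sub_corner_self)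
open B9GeoLemma21KLevelV1 (geo9K_eta_pos)
open Node00 (SiteY BlkY CfgY blkCornerY parTaxiV parSymY parSymY_of_le parSymY_mem)

variable {𝔸 : Type} [NormedRing 𝔸] [NormedAlgebra ℂ 𝔸] [CompleteSpace 𝔸] [NormOneClass 𝔸]
variable {d ℓ : ℕ} {hd : 1 ≤ d + 1} {hL : Odd (ℓ + 1) ∧ 1 < ℓ + 1} {b₀ b₁ : ℝ} (i : KIdx d ℓ hd hL b₀ b₁) (G : Subgroup 𝔸ˣ)
  (R : ℝ → CfgY 𝔸 i → Prop)

/-- ★ **THE LAW `ParVar337Y` AT THE STRAIGHT TRANSPORTER `parSymY`** (unit-norm `G`): `C_p = 2(d+1)e^{(d+1)/2}`, `α_K = 1∕4`, any regularity predicate `R`, any threshold `a_K` —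
at the corner pair `(c_{s(w)}, w)` the straight table is the taxicab product from the corner, and p. 401's product estimate (`norm_parTaxiV_prod_sub_le`) bounds its
variation under a (3.37) multiplier by `2(d+1)e^{(d+1)/2}·α₁`. [cite: Balaban1985BackgroundPropagators, p.401, (3.37) p.396, (3.40) p.397; Balaban1984PropagatorsII, (2.1) p.224] -/
theorem parVar337Y_parSymY (hG1 : ∀ u : 𝔸ˣ, u ∈ G → ‖(u : 𝔸)‖ ≤ 1) (aK : ℝ) :
    ParVar337Y G i (parSymY i) R (2 * ((d : ℝ) + 1) * Real.exp (((d : ℝ) + 1) / 2)) (1 / 4) aK := by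
  intro α₀ U _ _ _ hU α₁ a hα₁ hα₁4 h w
  set η : ℝ := (kGeo i).eta with hη
  have hη0 : 0 < η := geo9K_eta_pos i
  set s : BlkY i := blkY i w with hs
  have hws : blkOf i.D.toDomains w = s := by rw [hs, blkY_apply]
  -- the straight table at the corner pair is the taxicab product from the corner
  set p := (boxEquiv i.hN).symm (blkCornerY i s)
  set t := (boxEquiv i.hN).symm w
  have hle := toLex_corner_le i s hws
  have hW : parSymY i (mulY i (fluct η a) U) (blkCornerY i s) w = parTaxiV (mulY i (fluct η a) U) p t := parSymY_of_le hle
  have hV : parSymY i U (blkCornerY i s) w = parTaxiV U p t := parSymY_of_le hle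
  -- the own-level (3.37) on the block of `w`, in the shape of the taxicab estimate
  have hLeq : (kGeo i).L = (((ℓ + 1 : ℕ) : ℝ)) := rfl
  obtain ⟨hA, -⟩ := h
  have ha : ∀ (ν : Fin (d + 1)) (v : Site (PV d ℓ i.m i.K hd hL) 0), blkOf i.D.toDomains (toBox i.hN v) = s →
      η * ‖a ν v‖ ≤ α₁ * ((((ℓ + 1) ^ s.1.1 : ℕ) : ℝ))⁻¹ := by
    intro ν v hv
    have hlev : levV1 i v = s.1.1 := by
      show i.D.lev (toBox i.hN v).1 = _; rw [← hv]; rfl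
    have hb := hA _ ν v (le_of_eq hlev.symm)
    have e : scaleLen (kGeo i).L (kGeo i).eta s.1.1 = (((ℓ + 1) ^ s.1.1 : ℕ) : ℝ) * η := by
      rw [scaleLen, hLeq]; push_cast; ring
    rw [e, mul_inv] at hb
    have hpow : (0 : ℝ) < (((ℓ + 1) ^ s.1.1 : ℕ) : ℝ) := by positivity
    calc η * ‖a ν v‖ ≤ η * (α₁ * (((((ℓ + 1) ^ s.1.1 : ℕ) : ℝ))⁻¹ * η⁻¹)) := mul_le_mul_of_nonneg_left hb.le hη0.le
      _ = α₁ * ((((ℓ + 1) ^ s.1.1 : ℕ) : ℝ))⁻¹ := by field_simp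
  obtain ⟨hsub, -, -, -⟩ := norm_parTaxiV_prod_sub_le i G hG1 hU hη0.le a s hα₁.le hα₁4 ha p t (val_sub_corner_self i s)
    (fun μ => (val_sub_corner i s hws μ).2)
  rw [hW, hV]
  exact hsub

omit [NormOneClass 𝔸] in
/-- **THE LAW `ParMemY` AT THE STRAIGHT TRANSPORTER** for every regularity predicate implying «`U` is `G`-valued» (def-Y's `parSymY_mem`: products of `G`-valued bond variables
and their inverses). [cite: Balaban1985BackgroundPropagators, (3.40) p.397, (3.35) p.396] -/
theorem parMemY_parSymY (aK : ℝ) (hR : ∀ α₀ U, R α₀ U → GVal G i U) : ParMemY G i (parSymY i) R aK :=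
  fun α₀ U _ _ hreg z w => parSymY_mem i (hR α₀ U hreg) z w

end Literature.MathematicalPhysics.QuantumFieldTheory.Balaban1983to89.B9SectBCodedClassKnitYStraight

end
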